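/-
  HodgeLocusCensusInclusionRankComplement.lean — pub-hlocus ENGINE B (ivhs-2, gen 55), PROBE 16a (successor material, R-L573 (e); probe-only, NOT filed).
  certified instances and evidence bearing on the general Hodge conjecture; no claim.

  KERNEL RANK THEOREMS (evidence class; linear algebra of inclusion matrices; nothing about HC). WILSON'S THEOREM ON THE WHOLE RANGE AND THE RANK OF A BLOCK.
  W_{t,n}(α) S T = [S ⊆ T] (#S = t, #T = n; W-convention of anchors 204/230/231/271). (C1) COMPLEMENT SYMMETRY `rank_incl_eq_rank_incl_compl`:
  rank W_{t,n}(α) = rank W_{#α−n,#α−t}(α) for t, n ≤ #α (S ↦ Sᶜ turns [S ⊆ T] into [Tᶜ ⊆ Sᶜ]: W_{t,n} is the transpose of a reindexing of W_{#α−n,#α−t};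
  `Matrix.rank_transpose`, `Matrix.rank_submatrix`). (C2) n < t ⇒ rank 0 (`rank_incl_eq_zero_of_lt`); (C3) #α < n ⇒ rank 0 (`rank_incl_eq_zero_of_card_lt`).
  (C4) `rank_incl_eq_sum_of_card_lt`: for [CharP K p], t ≤ n ≤ #α and #α < t + n,
      rank W_{t,n}(α) = Σ_{j ≤ #α−n, p ∤ C(#α−t−j, #α−n−j)} (C(#α,j) − C(#α,j−1))
  — PROBE 15e's `rank_incl_eq_sum` (Wilson 1990, Theorem 1, the range t + n ≤ #α) applied to W_{#α−n,#α−t} via (C1); with 15e this gives the rank of every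
  W_{t,n}(α). (C5) `rank_smul_incl_eq`: the rank of a block c!·W_{t,t+c}(α) — the shape of the blocks of anchor 230's `rank_mulDeltaPow_levels_eq_sum` — when
  c! ≠ 0 in K: 0 if #α < t + c; Wilson's sum if 2t + c ≤ #α; the complementary sum (C4) otherwise (anchor 220's `rank_smul_of_ne_zero`); (C5′)
  `cast_factorial_ne_zero`: c! ≠ 0 in K for a prime characteristic p > c.
  6 theorems, 0 defs; imports PROBE 15e `…HodgeLocusCensusInclusionRankLift` and anchor 220 `…HodgeLocusCensusUnitColumnRankD3LevelsPowers` by name;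
  no sorries, axioms, instances or notation.
-/
import Summits.HodgeConjecture.HodgeConjecture.Theorems.HodgeLocusCensusInclusionRankLift
import Summits.HodgeConjecture.HodgeConjecture.Theorems.HodgeLocusCensusUnitColumnRankD3LevelsPowers

set_option linter.dupNamespace false
set_option autoImplicit false

namespace Summit.HodgeConjecture.HodgeConjecture.HodgeLocus.Census.InclusionRankComplement

open Summit.HodgeConjecture.HodgeConjecture.HodgeLocus.Census.InclusionRankLift

variable (K : Type*) [Field K] {α : Type*} [Fintype α] [DecidableEq α]

/-! ## §8 complement symmetry and the full range -/

/-- (C1) COMPLEMENT SYMMETRY: `rank W_{t,n}(α) = rank W_{#α-n,#α-t}(α)` — the bijections `S ↦ Sᶜ`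
carry `[S ⊆ T]` to `[Tᶜ ⊆ Sᶜ]`, so `W_{t,n}` is the transpose of a reindexing of `W_{#α-n,#α-t}`. -/
theorem rank_incl_eq_rank_incl_compl (t n : ℕ) (ht : t ≤ Fintype.card α) (hn : n ≤ Fintype.card α) :
    (Matrix.of fun (S : {S : Finset α // S.card = t}) (T : {S : Finset α // S.card = n}) =>
        if S.1 ⊆ T.1 then (1 : K) else 0).rank =
      (Matrix.of fun (S : {S : Finset α // S.card = Fintype.card α - n})
          (T : {S : Finset α // S.card = Fintype.card α - t}) =>
        if S.1 ⊆ T.1 then (1 : K) else 0).rank := by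
  have hc : ∀ (k : ℕ) (S : Finset α), S.card = k → Sᶜ.card = Fintype.card α - k := by
    intro k S h
    rw [Finset.card_compl, h]
  obtain ⟨en, hen⟩ : ∃ e : {S : Finset α // S.card = n} ≃ {S : Finset α // S.card = Fintype.card α - n},
      ∀ S, (e S).1 = S.1ᶜ :=
    ⟨{ toFun := fun S => ⟨S.1ᶜ, hc n S.1 S.2⟩
       invFun := fun S => ⟨S.1ᶜ, by rw [hc _ S.1 S.2, Nat.sub_sub_self hn]⟩
       left_inv := fun S => Subtype.ext (compl_compl S.1)
       right_inv := fun S => Subtype.ext (compl_compl S.1) }, fun S => rfl⟩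
  obtain ⟨et, het⟩ : ∃ e : {S : Finset α // S.card = t} ≃ {S : Finset α // S.card = Fintype.card α - t},
      ∀ S, (e S).1 = S.1ᶜ :=
    ⟨{ toFun := fun S => ⟨S.1ᶜ, hc t S.1 S.2⟩
       invFun := fun S => ⟨S.1ᶜ, by rw [hc _ S.1 S.2, Nat.sub_sub_self ht]⟩
       left_inv := fun S => Subtype.ext (compl_compl S.1)
       right_inv := fun S => Subtype.ext (compl_compl S.1) }, fun S => rfl⟩
  have hW : (Matrix.of fun (S : {S : Finset α // S.card = t}) (T : {S : Finset α // S.card = n}) =>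
        if S.1 ⊆ T.1 then (1 : K) else 0) =
      ((Matrix.of fun (S : {S : Finset α // S.card = Fintype.card α - n})
          (T : {S : Finset α // S.card = Fintype.card α - t}) =>
        if S.1 ⊆ T.1 then (1 : K) else 0).submatrix en et).transpose := by
    ext S T
    rw [Matrix.transpose_apply, Matrix.submatrix_apply, Matrix.of_apply, Matrix.of_apply, hen, het]
    exact (if_congr Finset.compl_subset_compl rfl rfl).symm
  rw [hW, Matrix.rank_transpose, Matrix.rank_submatrix]

/-- (C2) no inclusions when `n < t`: the matrix is zero. -/
theorem rank_incl_eq_zero_of_lt (t n : ℕ) (h : n < t) :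
    (Matrix.of fun (S : {S : Finset α // S.card = t}) (T : {S : Finset α // S.card = n}) =>
        if S.1 ⊆ T.1 then (1 : K) else 0).rank = 0 := by
  have h0 : (Matrix.of fun (S : {S : Finset α // S.card = t}) (T : {S : Finset α // S.card = n}) =>
        if S.1 ⊆ T.1 then (1 : K) else 0) = 0 := by
    ext S T
    rw [Matrix.of_apply, Matrix.zero_apply, if_neg]
    intro hST
    have hle := Finset.card_le_card hST
    rw [S.2, T.2] at hle
    omega
  rw [h0, Matrix.rank_zero]

/-- (C3) no columns when `#α < n`. -/
theorem rank_incl_eq_zero_of_card_lt (t n : ℕ) (h : Fintype.card α < n) :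
    (Matrix.of fun (S : {S : Finset α // S.card = t}) (T : {S : Finset α // S.card = n}) =>
        if S.1 ⊆ T.1 then (1 : K) else 0).rank = 0 := by
  have he : IsEmpty {S : Finset α // S.card = n} :=
    ⟨fun T => by
      have hle := Finset.card_le_univ T.1
      rw [T.2] at hle
      omega⟩
  have hw := Matrix.rank_le_card_width
    (Matrix.of fun (S : {S : Finset α // S.card = t}) (T : {S : Finset α // S.card = n}) =>
        if S.1 ⊆ T.1 then (1 : K) else 0)
  rw [Fintype.card_eq_zero] at hw
  omega

/-- (C4) WILSON'S THEOREM ON THE COMPLEMENTARY RANGE `#α < t + n` (with `t ≤ n ≤ #α`): by (C1) and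
Wilson's theorem for `W_{#α-n,#α-t}`, whose parameters satisfy `(#α-n) + (#α-t) ≤ #α`. -/
theorem rank_incl_eq_sum_of_card_lt (p : ℕ) [CharP K p] (t n : ℕ) (htn : t ≤ n)
    (hn : n ≤ Fintype.card α) (hm : Fintype.card α < t + n) :
    (Matrix.of fun (S : {S : Finset α // S.card = t}) (T : {S : Finset α // S.card = n}) =>
        if S.1 ⊆ T.1 then (1 : K) else 0).rank =
      ∑ j ∈ Finset.range (Fintype.card α - n + 1),
        if p ∣ (Fintype.card α - t - j).choose (Fintype.card α - n - j) then 0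
        else ((Fintype.card α).choose j - if j = 0 then 0 else (Fintype.card α).choose (j - 1)) := by
  rw [rank_incl_eq_rank_incl_compl K t n (le_trans htn hn) hn]
  exact rank_incl_eq_sum K p (Fintype.card α - n) (Fintype.card α - t) (by omega) (by omega)

/-- (C5) THE RANK OF A BLOCK `c! • W_{t,t+c}(α)` (the shape of the blocks of anchor 230's
`rank_mulDeltaPow_levels_eq_sum`) whenever `c!` is nonzero in `K`: zero if `#α < t + c`, Wilson's sum
if `2t + c ≤ #α`, the complementary Wilson sum otherwise. -/
theorem rank_smul_incl_eq (p : ℕ) [CharP K p] (c t : ℕ) (hc : ((c.factorial : ℕ) : K) ≠ 0) :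
    ((((c.factorial : ℕ) : K)) • Matrix.of
        (fun (T : {Z : Finset α // Z.card = t}) (U : {Z : Finset α // Z.card = t + c}) =>
          if T.1 ⊆ U.1 then (1 : K) else 0)).rank =
      if Fintype.card α < t + c then 0
      else if t + (t + c) ≤ Fintype.card α then
        ∑ j ∈ Finset.range (t + 1),
          if p ∣ (t + c - j).choose (t - j) then 0
          else ((Fintype.card α).choose j - if j = 0 then 0 else (Fintype.card α).choose (j - 1))
      else
        ∑ j ∈ Finset.range (Fintype.card α - (t + c) + 1),
          if p ∣ (Fintype.card α - t - j).choose (Fintype.card α - (t + c) - j) then 0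
          else ((Fintype.card α).choose j - if j = 0 then 0 else (Fintype.card α).choose (j - 1)) := by
  rw [Summit.HodgeConjecture.HodgeConjecture.HodgeLocus.Census.UnitColumnRankD3LevelsPowers.rank_smul_of_ne_zero _ _ hc]
  by_cases h1 : Fintype.card α < t + c
  · rw [if_pos h1]
    exact rank_incl_eq_zero_of_card_lt K t (t + c) h1
  rw [if_neg h1]
  by_cases h2 : t + (t + c) ≤ Fintype.card α
  · rw [if_pos h2]
    exact rank_incl_eq_sum K p t (t + c) (Nat.le_add_right t c) h2
  rw [if_neg h2]
  exact rank_incl_eq_sum_of_card_lt K p t (t + c) (Nat.le_add_right t c) (by omega) (by omega)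

/-- (C5') in particular for a prime `p > c` (THEOREM L's modular regime `c < p`). -/
theorem cast_factorial_ne_zero (p : ℕ) [CharP K p] (hp : p.Prime) (c : ℕ) (hcp : c < p) :
    ((c.factorial : ℕ) : K) ≠ 0 := by
  rw [Ne, CharP.cast_eq_zero_iff K p, hp.dvd_factorial]
  omega

end Summit.HodgeConjecture.HodgeConjecture.HodgeLocus.Census.InclusionRankComplement
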